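import Literature.NumberTheory.Automorphic.UnitaryGroupTorusSiegelCoordinates
import Literature.NumberTheory.Automorphic.UnitaryGroupBorelHeightContinuous
import Literature.NumberTheory.Automorphic.UnitaryGroupBorelTruncation
import Literature.NumberTheory.Automorphic.NormOneIdeleClassCompact
import HarnessLib

/-!
# The torus Siegel set `S_T ⊆ T(𝔸_F)` of the quasi-split `U(J₃)` (brick H9a of the T1-qs law)

Topic `NumberTheory/Automorphic`; namespace `Literature.NumberTheory.Automorphic.UnitaryGroup`.  THEOREMS ONLY (no
definition, no named fact, no instance, no notation, no `sorry`).  Setting: `E/F` quadratic with non-trivial automorphism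
`c` (`Module.finrank F E = 2`, `c ≠ 1`), `G = U(J₃)(𝔸_F) = (quasiSplit F E c 3).Adelic`, `B(𝔸_F) = borelAdelic F E c 3`,
torus part `torusPart`, diagonal entries `diagUnit`, Borel height `borelHeight` (★ `UnitaryGroupBorelSemidirect`,
★ `UnitaryGroupBorelHeight`); the torus is `T(𝔸_F) = {diag(d₀, d₁, (c d₀)⁻¹) : c(d₁) d₁ = 1}`.

**`exists_torusSiegelSet`** (Rogawski (1990), §2.2: the `A_t`-part of a Siegel set `ω A_t K` of `U(3)`, with the anisotropic
`U(1)` and the norm-one classes absorbed into compacta): with the compact covers `W₀ ⊆ 𝕀_E¹` (`𝕀_E = W₀ · ι(Eˣ) · ρ(ℝ_{>0})`)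
and `W₁ ⊆ U(1)(𝔸_F)` (`U(1)(𝔸_F) = W₁ · U(1)(F)`) of ★ `UnitaryGroupTorusSiegelCoordinates`, the set
`S_T = {t ∈ T(𝔸_F) : d₀(t) ∈ W₀ · ρ(ℝ_{>0}), d₁(t) ∈ W₁}` is CLOSED, consists of torus elements, exports its coordinates
(`d₀ = w ρ(e^s)`, `d₁ ∈ W`, `‖d₀‖_𝔸 = e^{[E:ℚ] s}`, `H(t) = ‖d₀‖_𝔸 · H(1)`), is reached from EVERY torus element by a rational
torus element of `B(𝔸_F) ∩ G(F)` (total cover: `S_T` carries all heights), its root values `d₀⁻¹ d₁`, `d₀⁻¹ d₂` lie in compact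
windows `R₁, R₂ ⊆ 𝔸_E` above height `1` (the letters of ★ H4-d ∕ ★ H9b `exists_isCompact_structure_of_mem_siegel`), and the
archimedean components of `d₀⁻¹ d₁` are `≤ κ · H(t)^{−1/[E:ℚ]}` on all of `S_T` (BALANCE, the per-place input of H5b ∕ H10b).

* §1 compact adelic windows: `isCompact_coe_mul_integralBox` (`(val '' K) · {integral, arch ≤ R}` compact),
  `coe_posRealIdele_mem_integralBox`; root-value formulas on the ray (`rootValue₁_eq`, `rootValue₂_eq`); bounded archimedean
  components on a compact of `𝕀_E`.
* §2 the theorem.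

HC_CM is proved only modulo the printed citations until rung 0 closes.

## References
* J. D. Rogawski, *Automorphic Representations of Unitary Groups in Three Variables* (1990), §2.2 (p. 13) [Rogawski1990].
* R. Godement, *Domaines fondamentaux des groupes arithmétiques*, Sém. Bourbaki 257 (1964), §5 [Godement1964].
* J. W. S. Cassels, A. Fröhlich (eds.), *Algebraic Number Theory* (1967), Ch. II §16 [CasselsFrohlichANT1967].
-/

set_option autoImplicit false

noncomputable section

open NumberField IsDedekindDomain Matrix Topology
open scoped NNReal Pointwise

namespace Literature.NumberTheory.Automorphic

namespace UnitaryGroup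

/-! ## §1 Compact adelic windows, root values on the ray, bounded archimedean components -/

section Windows

variable (E : Type) [Field E] [NumberField E]

/-- **compact window**: for a compact `K ⊆ 𝕀_E` and `R : ℝ`, the set `K · {a : integral at finite places, ‖a_w‖ ≤ R}` is a
compact subset of `𝔸_E`. [cite: CasselsFrohlichANT1967, Ch. II §16] -/
theorem isCompact_coe_mul_integralBox {K : Set (AdeleRing (𝓞 E) E)ˣ} (hK : IsCompact K) (R : ℝ) :
    IsCompact ((fun p : AdeleRing (𝓞 E) E × AdeleRing (𝓞 E) E => p.1 * p.2) ''
      ((((↑) : (AdeleRing (𝓞 E) E)ˣ → AdeleRing (𝓞 E) E) '' K) ×ˢ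
        {a : AdeleRing (𝓞 E) E | (∀ v : HeightOneSpectrum (𝓞 E), a.2 v ∈ v.adicCompletionIntegers E) ∧
          ∀ w : InfinitePlace E, ‖a.1 w‖ ≤ R})) :=
  ((hK.image Units.continuous_val).prod (isCompact_integralAdeles_norm_le E R)).image (continuous_fst.mul continuous_snd)

/-- `ρ(u)` lies in the integral box of radius `R` when `u ≤ R` (finite components `1`, archimedean components of norm `u`).
[cite: CasselsFrohlichANT1967, Ch. II §16] -/
theorem coe_posRealIdele_mem_integralBox {u : ℝ≥0ˣ} {R : ℝ} (hu : ((u : ℝ≥0) : ℝ) ≤ R) :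
    ((posRealIdele E u : (AdeleRing (𝓞 E) E)ˣ) : AdeleRing (𝓞 E) E) ∈
      {a : AdeleRing (𝓞 E) E | (∀ v : HeightOneSpectrum (𝓞 E), a.2 v ∈ v.adicCompletionIntegers E) ∧
        ∀ w : InfinitePlace E, ‖a.1 w‖ ≤ R} := by
  refine ⟨fun v => ?_, fun w => ?_⟩
  · rw [posRealIdele_snd_apply]; exact one_mem _
  · rw [← coe_nnnorm, nnnorm_posRealIdele_fst_apply]; exact hu

/-- **bounded archimedean components on a compact of `𝕀_E`**: `‖u_w‖ ≤ C` for all `u ∈ K`, `w ∣ ∞`.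
[cite: CasselsFrohlichANT1967, Ch. II §16] -/
theorem exists_forall_norm_fst_apply_le {K : Set (AdeleRing (𝓞 E) E)ˣ} (hK : IsCompact K) :
    ∃ C : ℝ, 0 ≤ C ∧ ∀ u ∈ K, ∀ w : InfinitePlace E, ‖((u : (AdeleRing (𝓞 E) E)ˣ) : AdeleRing (𝓞 E) E).1 w‖ ≤ C := by
  have hf : Continuous fun u : (AdeleRing (𝓞 E) E)ˣ =>
      ∑ w : InfinitePlace E, ‖((u : (AdeleRing (𝓞 E) E)ˣ) : AdeleRing (𝓞 E) E).1 w‖ :=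
    continuous_finsetSum _ fun w _ =>
      continuous_norm.comp ((continuous_apply w).comp (continuous_fst.comp Units.continuous_val))
  obtain ⟨C, hC⟩ := hK.exists_bound_of_continuousOn hf.continuousOn
  refine ⟨max C 0, le_max_right _ _, fun u hu w => ?_⟩
  have h1 : ‖((u : (AdeleRing (𝓞 E) E)ˣ) : AdeleRing (𝓞 E) E).1 w‖ ≤
      ∑ w' : InfinitePlace E, ‖((u : (AdeleRing (𝓞 E) E)ˣ) : AdeleRing (𝓞 E) E).1 w'‖ :=
    Finset.single_le_sum (f := fun w' => ‖((u : (AdeleRing (𝓞 E) E)ˣ) : AdeleRing (𝓞 E) E).1 w'‖)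
      (fun w' _ => norm_nonneg _) (Finset.mem_univ w)
  have h2 := hC u hu
  rw [Real.norm_eq_abs, abs_of_nonneg (Finset.sum_nonneg fun w' _ => norm_nonneg _)] at h2
  exact (h1.trans h2).trans (le_max_left _ _)

end Windows

/-! ## §2 The torus Siegel set -/

section SiegelSet

variable (F E : Type) [Field F] [NumberField F] [Field E] [NumberField E] [Algebra F E] (c : E ≃ₐ[F] E)

/-- `e^{log u} = u` for a positive unit of `ℝ≥0` (★ `expUnitNNReal_log` of `SiegelConeDyadic`, whose cone is not
imported here). [folklore] -/
private theorem expUnitNNReal_log'' (u : ℝ≥0ˣ) : expUnitNNReal (Real.log ((u : ℝ≥0) : ℝ)) = u :=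
  Units.ext (NNReal.eq (by
    rw [coe_expUnitNNReal]
    exact Real.exp_log (NNReal.coe_pos.2 (pos_iff_ne_zero.2 u.ne_zero))))

/-- `b ↦ diagUnit b i` is continuous on `B(𝔸_F)` (entries of `b` and of `b⁻¹`; cf. ★ `UnitaryGroupBorelSiegelSetStructure`).
[cite: Rogawski1990, §1.10] -/
private theorem continuous_diagUnit' {N : ℕ} : Continuous fun b : borelAdelic F E c N => diagUnit b.2 := by
  have hmat : Continuous fun g : (quasiSplit F E c N).Adelic =>
      (adelicVal F E c N _ g : Matrix (Fin N) (Fin N) (AdeleRing (𝓞 E) E)) :=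
    Units.continuous_val.comp continuous_subtype_val
  refine continuous_pi fun i => Units.continuous_iff.2 ⟨?_, ?_⟩
  · exact (hmat.comp continuous_subtype_val).matrix_elem i i
  · change Continuous fun b : borelAdelic F E c N =>
      (adelicVal F E c N _ ((b : (quasiSplit F E c N).Adelic)⁻¹) : Matrix (Fin N) (Fin N) (AdeleRing (𝓞 E) E)) i i
    exact (hmat.comp continuous_subtype_val.inv).matrix_elem i i

/-- diagonal entries of a product of torus elements multiply (cf. ★ `UnitaryGroupBorelSiegelSetStructure`).
[cite: Rogawski1990, §1.10] -/
private theorem diagUnit_mul_of_torus {N : ℕ} {t t' : borelAdelic F E c N} (ht : torusPart t = t)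
    (ht' : torusPart t' = t') (i : Fin N) :
    diagUnit (t * t').2 i = diagUnit t.2 i * diagUnit t'.2 i := by
  refine Units.ext ?_
  rw [coe_diagUnit, Units.val_mul, coe_diagUnit, coe_diagUnit]
  change (adelicVal F E c N _ ((t : (quasiSplit F E c N).Adelic) * (t' : (quasiSplit F E c N).Adelic)) :
      Matrix (Fin N) (Fin N) (AdeleRing (𝓞 E) E)) i i = _
  rw [map_mul, Units.val_mul, adelicVal_eq_glDiagonal_diagUnit ht, adelicVal_eq_glDiagonal_diagUnit ht', coe_glDiagonal,
    coe_glDiagonal, Matrix.diagonal_mul_diagonal, Matrix.diagonal_apply_eq, Matrix.diagonal_apply_eq,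
    Matrix.diagonal_apply_eq]

/-- root values on the ray: with `d₀ = w ρ(u)`, `d₀⁻¹ d₁ = (w⁻¹ d₁) · ρ(u⁻¹)` in `𝔸_E`. [cite: Rogawski1990, §2.2 (p. 13)] -/
theorem coe_rootValue₁_eq {d₀ d₁ w : (AdeleRing (𝓞 E) E)ˣ} {u : ℝ≥0ˣ} (h : d₀ = w * posRealIdele E u) :
    (((d₀⁻¹ * d₁ : (AdeleRing (𝓞 E) E)ˣ)) : AdeleRing (𝓞 E) E) =
      ((w⁻¹ * d₁ : (AdeleRing (𝓞 E) E)ˣ) : AdeleRing (𝓞 E) E) *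
        ((posRealIdele E u⁻¹ : (AdeleRing (𝓞 E) E)ˣ) : AdeleRing (𝓞 E) E) := by
  rw [← Units.val_mul, h, map_inv, mul_inv]
  congr 1
  simp only [mul_assoc, mul_comm]

omit [NumberField F] in
/-- root values on the ray for `U(J₃)`: `d₂ = (c • d₀)⁻¹`, `c • ρ = ρ`, so `d₀⁻¹ d₂ = (w⁻¹ (c•w)⁻¹) · ρ(u⁻¹ u⁻¹)`.
[cite: Rogawski1990, §2.2 (p. 13)] -/
theorem coe_rootValue₂_eq {d₀ w : (AdeleRing (𝓞 E) E)ˣ} {u : ℝ≥0ˣ} (h : d₀ = w * posRealIdele E u) :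
    (((d₀⁻¹ * (c • d₀)⁻¹ : (AdeleRing (𝓞 E) E)ˣ)) : AdeleRing (𝓞 E) E) =
      ((w⁻¹ * (c • w)⁻¹ : (AdeleRing (𝓞 E) E)ˣ) : AdeleRing (𝓞 E) E) *
        ((posRealIdele E (u⁻¹ * u⁻¹) : (AdeleRing (𝓞 E) E)ˣ) : AdeleRing (𝓞 E) E) := by
  rw [← Units.val_mul, h, smul_mul', smul_posRealIdele, map_mul, map_inv, mul_inv, mul_inv]
  congr 1
  simp only [mul_assoc, mul_comm, mul_left_comm]

/-- **THE TORUS SIEGEL SET of `U(J₃)` (brick H9a).**  For `E/F` quadratic with non-trivial automorphism `c`: there are a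
CLOSED set `S_T ⊆ B(𝔸_F)` of torus elements and a compact `W ⊆ 𝕀_E` such that (EXPORT) every `t ∈ S_T` has first diagonal
entry `d₀ = w · ρ(e^s)` on the ray through `W`, second entry in `W`, `‖d₀‖_𝔸 = e^{[E:ℚ] s}` and height
`H(t) = ‖d₀‖_𝔸 · H(1)`; (COVER) every torus element is moved into `S_T` by a rational torus element of `B(𝔸_F) ∩ G(F)`;
(LETTERS) above height `1` the root values `d₀⁻¹ d₁`, `d₀⁻¹ d₂` lie in compact `R₁, R₂ ⊆ 𝔸_E`; (BALANCE) on all of `S_T` the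
archimedean components of `d₀⁻¹ d₁` are `≤ κ · H(t)^{−1/[E:ℚ]}`. [cite: Rogawski1990, §2.2 (p. 13)] [cite: Godement1964, §5 Thm. 4] -/
theorem exists_torusSiegelSet (h2 : Module.finrank F E = 2) (hc1 : c ≠ 1) :
    ∃ (S_T : Set (borelAdelic F E c 3)) (W : Set (AdeleRing (𝓞 E) E)ˣ),
      IsClosed S_T ∧ IsCompact W ∧
      (∀ t ∈ S_T, torusPart t = t) ∧
      (∀ t ∈ S_T, ∃ w ∈ W, ∃ s : ℝ,
          diagUnit t.2 0 = w * posRealIdele E (expUnitNNReal s) ∧ diagUnit t.2 1 ∈ W ∧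
          IdeleClassGroup.ideleNorm E (diagUnit t.2 0) = ((expUnitNNReal (Module.finrank ℚ E * s) : ℝ≥0ˣ) : ℝ≥0) ∧
          borelHeight (t : (quasiSplit F E c 3).Adelic) =
            IdeleClassGroup.ideleNorm E (diagUnit t.2 0) * borelHeight (1 : (quasiSplit F E c 3).Adelic)) ∧
      (∀ t : borelAdelic F E c 3, torusPart t = t →
        ∃ τ : borelAdelic F E c 3, (τ : (quasiSplit F E c 3).Adelic) ∈ (quasiSplit F E c 3).arithmeticSubgroup ∧
          torusPart τ = τ ∧ τ * t ∈ S_T) ∧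
      (∃ R₁ R₂ : Set (AdeleRing (𝓞 E) E), IsCompact R₁ ∧ IsCompact R₂ ∧ ∀ t ∈ S_T,
          1 ≤ borelHeight (t : (quasiSplit F E c 3).Adelic) →
          (((diagUnit t.2 0)⁻¹ * diagUnit t.2 1 : (AdeleRing (𝓞 E) E)ˣ) : AdeleRing (𝓞 E) E) ∈ R₁ ∧
          (((diagUnit t.2 0)⁻¹ * diagUnit t.2 2 : (AdeleRing (𝓞 E) E)ˣ) : AdeleRing (𝓞 E) E) ∈ R₂) ∧
      (∃ κ : ℝ, ∀ t ∈ S_T, ∀ w : InfinitePlace E,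
          ‖((((diagUnit t.2 0)⁻¹ * diagUnit t.2 1 : (AdeleRing (𝓞 E) E)ˣ) : AdeleRing (𝓞 E) E)).1 w‖ ≤
            κ * ((borelHeight (t : (quasiSplit F E c 3).Adelic) : ℝ) ^ (-(1 / (Module.finrank ℚ E : ℝ))))) := by
  classical
  haveI : FiniteDimensional F E := Module.finite_of_finrank_eq_succ h2
  -- `c² = 1`
  have hcc : ∀ x : E, c (c x) = x := by
    intro x
    rcases algEquiv_eq_one_or_eq F E c h2 hc1 (c * c) with h | h
    · exact congrArg (fun f : E ≃ₐ[F] E => f x) h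
    · exact absurd (mul_left_cancel (a := c) (h.trans (mul_one c).symm)) hc1
  -- the two covers
  obtain ⟨W₀, hW₀c, hW₀1, hcov₀⟩ := exists_isCompact_normOne_ray_cover E
  obtain ⟨W₁, hW₁c, hW₁sub, hcov₁⟩ := exists_isCompact_adelicOne_cover F E c h2 hc1
  -- the set
  set ST : Set (borelAdelic F E c 3) := {t | torusPart t = t ∧
    diagUnit t.2 0 ∈ W₀ * (posRealIdeles E : Set (AdeleRing (𝓞 E) E)ˣ) ∧ diagUnit t.2 1 ∈ W₁} with hST
  -- constants: `n = [E:ℚ]`, `H₁ = H(1) > 0`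
  set n : ℕ := Module.finrank ℚ E with hn
  have hn0 : n ≠ 0 := Module.finrank_pos.ne'
  set H₁ : ℝ≥0 := borelHeight (1 : (quasiSplit F E c 3).Adelic) with hH₁
  have hH₁0 : 0 < H₁ := by
    rw [hH₁, borelHeight_def]; exact inv_pos.2 (vecHeight_lastRow_pos _)
  -- EXPORT data of an element of `ST`
  have hexp : ∀ t ∈ ST, ∃ w ∈ W₀, ∃ u : ℝ≥0ˣ, diagUnit t.2 0 = w * posRealIdele E u ∧ diagUnit t.2 1 ∈ W₁ ∧
      IdeleClassGroup.ideleNorm E (diagUnit t.2 0) = (u : ℝ≥0) ^ n ∧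
      borelHeight (t : (quasiSplit F E c 3).Adelic) = (u : ℝ≥0) ^ n * H₁ := by
    rintro t ⟨ht, ⟨w, hw, p, ⟨u, rfl⟩, hwp⟩, h1⟩
    have hd0 : diagUnit t.2 0 = w * posRealIdele E u := hwp.symm
    have hnorm : IdeleClassGroup.ideleNorm E (diagUnit t.2 0) = (u : ℝ≥0) ^ n := by
      rw [hd0, map_mul, hW₀1 w hw, one_mul, ideleNorm_posRealIdele_holds E u]
    refine ⟨w, hw, u, hd0, h1, hnorm, ?_⟩
    have h := borelHeight_torus_mul' (adelicVal_eq_glDiagonal_diagUnit ht).symm (1 : (quasiSplit F E c 3).Adelic)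
    rw [mul_one] at h
    rw [h, hnorm]
  refine ⟨ST, W₀ ∪ W₁, ?_, hW₀c.union hW₁c, fun t ht => ht.1, ?_, ?_, ?_, ?_⟩
  · -- closed
    haveI := t2Space_borelAdelic (F := F) (E := E) (c := c) (N := 3)
    haveI := t2Space_ideleGroup E
    have hA : IsClosed {t : borelAdelic F E c 3 | torusPart t = t} := isClosed_eq continuous_torusPart continuous_id
    have hB : IsClosed {t : borelAdelic F E c 3 | diagUnit t.2 0 ∈ W₀ * (posRealIdeles E : Set (AdeleRing (𝓞 E) E)ˣ)} :=
      ((isClosed_posRealIdeles E).mul_left_of_isCompact hW₀c).preimage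
        ((continuous_apply 0).comp (continuous_diagUnit' F E c))
    have hC : IsClosed {t : borelAdelic F E c 3 | diagUnit t.2 1 ∈ W₁} :=
      hW₁c.isClosed.preimage ((continuous_apply 1).comp (continuous_diagUnit' F E c))
    rw [hST, Set.setOf_and, Set.setOf_and]
    exact hA.inter (hB.inter hC)
  · -- EXPORT
    intro t ht
    obtain ⟨w, hw, u, hd0, h1, hnorm, hH⟩ := hexp t ht
    refine ⟨w, Or.inl hw, Real.log ((u : ℝ≥0) : ℝ), ?_, Or.inr h1, ?_, ?_⟩
    · rw [expUnitNNReal_log'']; exact hd0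
    · rw [hnorm]
      apply NNReal.eq
      rw [NNReal.coe_pow, coe_expUnitNNReal, Real.exp_nat_mul,
        Real.exp_log (NNReal.coe_pos.2 (pos_iff_ne_zero.2 u.ne_zero))]
    · rw [hH, hnorm]
  · -- COVER
    intro t ht
    obtain ⟨w, hw, k, s, hk⟩ := hcov₀ (diagUnit t.2 0)
    obtain ⟨q, hq1, hq⟩ := hcov₁ (diagUnit t.2 1) (diagUnit_one_mem_adelicOne ht)
    -- `c q · q = 1` in `E`
    have hqE : c (q : E) * q = 1 := by
      have h := (mem_adelicOne_iff F E c _).1 hq1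
      rw [principalIdele_eq_unitsMap, Units.coe_map, MonoidHom.coe_coe, ← algebraMap_conj, ← map_mul] at h
      exact (AdeleRing.algebraMap_injective (𝓞 E) E) (h.trans (map_one _).symm)
    obtain ⟨τ, hτrat, hτ, hτ0, hτ1⟩ := exists_rational_torus (F := F) hcc k q hqE
    refine ⟨τ, hτrat, hτ, ?_, ?_, ?_⟩
    · rw [torusPart_mul, hτ, ht]
    · rw [diagUnit_mul_of_torus F E c hτ ht 0, hτ0, mul_comm (principalIdele E k), hk]
      exact Set.mul_mem_mul hw (posRealIdele_mem_posRealIdeles E _)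
    · rw [diagUnit_mul_of_torus F E c hτ ht 1, hτ1, mul_comm (principalIdele E q)]; exact hq
  · -- LETTERS
    -- threshold: `1 ≤ H(t) = u^n H₁` forces `u⁻¹ ≤ M := H₁^{1/n}` (as reals)
    set M : ℝ := ((H₁ : ℝ≥0) : ℝ) ^ (1 / (n : ℝ)) with hM
    refine ⟨(fun p : AdeleRing (𝓞 E) E × AdeleRing (𝓞 E) E => p.1 * p.2) ''
        ((((↑) : (AdeleRing (𝓞 E) E)ˣ → AdeleRing (𝓞 E) E) '' (W₀⁻¹ * W₁)) ×ˢ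
          {a : AdeleRing (𝓞 E) E | (∀ v : HeightOneSpectrum (𝓞 E), a.2 v ∈ v.adicCompletionIntegers E) ∧
            ∀ w : InfinitePlace E, ‖a.1 w‖ ≤ M}),
      (fun p : AdeleRing (𝓞 E) E × AdeleRing (𝓞 E) E => p.1 * p.2) ''
        ((((↑) : (AdeleRing (𝓞 E) E)ˣ → AdeleRing (𝓞 E) E) '' ((fun w => w⁻¹ * (c • w)⁻¹) '' W₀)) ×ˢ
          {a : AdeleRing (𝓞 E) E | (∀ v : HeightOneSpectrum (𝓞 E), a.2 v ∈ v.adicCompletionIntegers E) ∧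
            ∀ w : InfinitePlace E, ‖a.1 w‖ ≤ M * M}),
      isCompact_coe_mul_integralBox E (hW₀c.inv.mul hW₁c) M,
      isCompact_coe_mul_integralBox E
        (hW₀c.image ((continuous_inv.mul (continuous_galSmul_idele F E c).inv))) (M * M),
      fun t ht hH1 => ?_⟩
    obtain ⟨w, hw, u, hd0, h1, hnorm, hH⟩ := hexp t ht
    -- `u⁻¹ ≤ M`
    have hu0 : (0 : ℝ) < ((u : ℝ≥0) : ℝ) := NNReal.coe_pos.2 (pos_iff_ne_zero.2 u.ne_zero)
    have huM : (((u⁻¹ : ℝ≥0ˣ) : ℝ≥0) : ℝ) ≤ M := by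
      rw [Units.val_inv_eq_inv_val, NNReal.coe_inv, hM]
      -- `1 ≤ u^n H₁` ⇒ `H₁⁻¹ ≤ u^n` ⇒ `u⁻¹ ≤ H₁^{1/n}`
      have h1' : (1 : ℝ) ≤ ((u : ℝ≥0) : ℝ) ^ n * ((H₁ : ℝ≥0) : ℝ) := by
        have := hH1; rw [hH] at this; exact_mod_cast this
      have hH₁r : (0 : ℝ) < ((H₁ : ℝ≥0) : ℝ) := NNReal.coe_pos.2 hH₁0
      have hun : (((u : ℝ≥0) : ℝ) ^ n)⁻¹ ≤ ((H₁ : ℝ≥0) : ℝ) := by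
        rw [inv_le_iff_one_le_mul₀ (pow_pos hu0 n)]
        linarith [mul_comm (((u : ℝ≥0) : ℝ) ^ n) ((H₁ : ℝ≥0) : ℝ)]
      have : (((u : ℝ≥0) : ℝ)⁻¹) = ((((u : ℝ≥0) : ℝ) ^ n)⁻¹) ^ (1 / (n : ℝ)) := by
        rw [← Real.rpow_natCast, ← Real.inv_rpow hu0.le, ← Real.rpow_mul (inv_nonneg.2 hu0.le),
          mul_one_div_cancel (Nat.cast_ne_zero.2 hn0), Real.rpow_one]
      rw [this]
      exact Real.rpow_le_rpow (inv_nonneg.2 (pow_nonneg hu0.le n)) hun (by positivity)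
    have huMM : (((u⁻¹ * u⁻¹ : ℝ≥0ˣ) : ℝ≥0) : ℝ) ≤ M * M := by
      have hu' : (0 : ℝ) ≤ (((u⁻¹ : ℝ≥0ˣ) : ℝ≥0) : ℝ) := NNReal.coe_nonneg _
      rw [Units.val_mul, NNReal.coe_mul]
      exact mul_le_mul huM huM hu' (hu'.trans huM)
    constructor
    · rw [coe_rootValue₁_eq E hd0, Set.image_mul_prod]
      exact Set.mul_mem_mul ⟨w⁻¹ * diagUnit t.2 1, Set.mul_mem_mul (Set.inv_mem_inv.2 hw) h1, rfl⟩
        (coe_posRealIdele_mem_integralBox E huM)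
    · rw [diagUnit_two_eq ht.1, coe_rootValue₂_eq F E c hd0, Set.image_mul_prod]
      exact Set.mul_mem_mul ⟨w⁻¹ * (c • w)⁻¹, ⟨w, hw, rfl⟩, rfl⟩ (coe_posRealIdele_mem_integralBox E huMM)
  · -- BALANCE
    obtain ⟨C, hC0, hC⟩ := exists_forall_norm_fst_apply_le E (hW₀c.inv.mul hW₁c)
    refine ⟨C * ((H₁ : ℝ≥0) : ℝ) ^ (1 / (n : ℝ)), fun t ht w' => ?_⟩
    obtain ⟨w, hw, u, hd0, h1, hnorm, hH⟩ := hexp t ht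
    have hu0 : (0 : ℝ) < ((u : ℝ≥0) : ℝ) := NNReal.coe_pos.2 (pos_iff_ne_zero.2 u.ne_zero)
    have hH₁r : (0 : ℝ) < ((H₁ : ℝ≥0) : ℝ) := NNReal.coe_pos.2 hH₁0
    -- `H(t)^{-1/n} = u⁻¹ · H₁^{-1/n}`
    have hpow : ((borelHeight (t : (quasiSplit F E c 3).Adelic) : ℝ≥0) : ℝ) ^ (-(1 / (n : ℝ))) =
        ((u : ℝ≥0) : ℝ)⁻¹ * (((H₁ : ℝ≥0) : ℝ) ^ (1 / (n : ℝ)))⁻¹ := by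
      rw [hH, NNReal.coe_mul, NNReal.coe_pow, Real.mul_rpow (pow_nonneg hu0.le n) hH₁r.le,
        Real.rpow_neg hH₁r.le, Real.rpow_neg (pow_nonneg hu0.le n), ← Real.rpow_natCast,
        ← Real.rpow_mul hu0.le, mul_one_div_cancel (Nat.cast_ne_zero.2 hn0), Real.rpow_one]
    have hfst : ∀ x y : AdeleRing (𝓞 E) E, (x * y).1 w' = x.1 w' * y.1 w' := fun _ _ => rfl
    rw [coe_rootValue₁_eq E hd0, hfst, norm_mul, hpow]
    have hρ : ‖((posRealIdele E u⁻¹ : (AdeleRing (𝓞 E) E)ˣ) : AdeleRing (𝓞 E) E).1 w'‖ = ((u : ℝ≥0) : ℝ)⁻¹ := by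
      rw [← coe_nnnorm, nnnorm_posRealIdele_fst_apply, Units.val_inv_eq_inv_val, NNReal.coe_inv]
    rw [hρ]
    have hb := hC (w⁻¹ * diagUnit t.2 1) (Set.mul_mem_mul (Set.inv_mem_inv.2 hw) h1) w'
    have hM0 : (0 : ℝ) < ((H₁ : ℝ≥0) : ℝ) ^ (1 / (n : ℝ)) := Real.rpow_pos_of_pos hH₁r _
    calc ‖((w⁻¹ * diagUnit t.2 1 : (AdeleRing (𝓞 E) E)ˣ) : AdeleRing (𝓞 E) E).1 w'‖ * ((u : ℝ≥0) : ℝ)⁻¹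
        ≤ C * ((u : ℝ≥0) : ℝ)⁻¹ := mul_le_mul_of_nonneg_right hb (inv_nonneg.2 hu0.le)
      _ = C * ((H₁ : ℝ≥0) : ℝ) ^ (1 / (n : ℝ)) * (((u : ℝ≥0) : ℝ)⁻¹ * (((H₁ : ℝ≥0) : ℝ) ^ (1 / (n : ℝ)))⁻¹) := by
          field_simp

end SiegelSet

end UnitaryGroup

end Literature.NumberTheory.Automorphic

end
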